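import Mathlib
import Literature.Probability.Percolation.Percolation
import Literature.Probability.Percolation.SitePaths
import Literature.Probability.LatticeModels.TriangularLattice
import Literature.Probability.LatticeModels.TriangularLatticeProofs
import Summits.CriticalPhenomena.CardyFormulaZ2.Theorems.CardyMagicRigidityHexSegmentDefs
import HarnessLib

/-!
# Stub `stub_siteEnd` (S2) of line `Sketch`, crux `LoopLimitZ2EqT` (stmt-CriticalPhenomena-4833):
# coordinates of adjacency in `𝕋` and the halving map

Helper file (`--supports stmt-CriticalPhenomena-4833`), lattice preliminaries of the cluster-level
arena identity (`CardyMagicRigidityLoopLimitZ2EqTSiteEndClusters.lean`) for the blow-up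
`β τ = {v | (∀ i, 2 ∣ v i) ∨ ⌊v/2⌋ ∈ τ}` of a cell set `τ` (`siteEnd_refine_upEdge_eq`):

* `siteEnd_adj_of_coords`, `siteEnd_adj_iff_coords`, `siteEnd_eq_or_adj_of_coords` (and primed
  forms with named coordinates, convenient for `omega`) — adjacency in the triangular lattice
  `triGraph` on `ℤ²` in coordinates (the six steps `±e₀, ±e₁, ±(1,-1)`; converse of the tree's
  `triGraph_adj_apply`);
* **`siteEnd_half_eq_or_adj`** — the halving map `v ↦ ⌊v/2⌋` (coordinatewise Euclidean
  quotient) is a weak graph homomorphism of `𝕋`: adjacent fine sites have equal or adjacent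
  half-cells;
* `siteEnd_not_adj_of_even` — two doubled vertices (corners) are never adjacent;
  `siteEnd_half_of_adj_even` — the six neighbours of the corner `2z` halve into the three cells
  `z, z - e₀, z - e₁` around the original vertex `z`, which are pairwise equal or adjacent
  (`siteEnd_eq_or_adj_of_near`); `siteEnd_half_eq_of_coords`.
-/

noncomputable section

open Set

namespace Summit.CriticalPhenomena.CardyFormulaZ2.Cruxes.LoopLimitZ2EqT.HexSegment

open Literature.Probability.Percolation Literature.Probability.LatticeModels

/-! ### Coordinates of adjacency in `𝕋` and the halving map -/

/-- Adjacency in `𝕋` from its six coordinate patterns (converse of `triGraph_adj_apply`). -/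
theorem siteEnd_adj_of_coords {x y : Site 2}
    (h : (y 0 = x 0 + 1 ∧ y 1 = x 1) ∨ (y 0 = x 0 ∧ y 1 = x 1 + 1) ∨
      (x 0 = y 0 + 1 ∧ x 1 = y 1) ∨ (x 0 = y 0 ∧ x 1 = y 1 + 1) ∨
      (y 0 = x 0 + 1 ∧ y 1 = x 1 - 1) ∨ (x 0 = y 0 + 1 ∧ x 1 = y 1 - 1)) :
    triGraph.Adj x y := by
  rw [triGraph_adj_iff_eq_add]
  have key : ∀ (v : Site 2), y 0 = x 0 + v 0 → y 1 = x 1 + v 1 → y = x + v := fun v h0 h1 => by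
    ext i; fin_cases i
    · simpa using h0
    · simpa using h1
  rcases h with h | h | h | h | h | h
  · exact Or.inl (key _ (by simp; omega) (by simp; omega))
  · exact Or.inr (Or.inr (Or.inl (key _ (by simp; omega) (by simp; omega))))
  · exact Or.inr (Or.inl (key _ (by simp; omega) (by simp; omega)))
  · exact Or.inr (Or.inr (Or.inr (Or.inl (key _ (by simp; omega) (by simp; omega)))))
  · exact Or.inr (Or.inr (Or.inr (Or.inr (Or.inl (key _ (by simp; omega) (by simp; omega))))))
  · exact Or.inr (Or.inr (Or.inr (Or.inr (Or.inr (key _ (by simp; omega) (by simp; omega))))))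

/-- Adjacency in `𝕋` in coordinates (`triGraph_adj_apply` and its converse). -/
theorem siteEnd_adj_iff_coords (x y : Site 2) :
    triGraph.Adj x y ↔ (y 0 = x 0 + 1 ∧ y 1 = x 1) ∨ (y 0 = x 0 ∧ y 1 = x 1 + 1) ∨
      (x 0 = y 0 + 1 ∧ x 1 = y 1) ∨ (x 0 = y 0 ∧ x 1 = y 1 + 1) ∨
      (y 0 = x 0 + 1 ∧ y 1 = x 1 - 1) ∨ (x 0 = y 0 + 1 ∧ x 1 = y 1 - 1) :=
  ⟨triGraph_adj_apply, siteEnd_adj_of_coords⟩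

/-- Equality or adjacency in `𝕋` from coordinate patterns. -/
theorem siteEnd_eq_or_adj_of_coords {x y : Site 2}
    (h : (y 0 = x 0 ∧ y 1 = x 1) ∨ (y 0 = x 0 + 1 ∧ y 1 = x 1) ∨ (y 0 = x 0 ∧ y 1 = x 1 + 1) ∨
      (x 0 = y 0 + 1 ∧ x 1 = y 1) ∨ (x 0 = y 0 ∧ x 1 = y 1 + 1) ∨
      (y 0 = x 0 + 1 ∧ y 1 = x 1 - 1) ∨ (x 0 = y 0 + 1 ∧ x 1 = y 1 - 1)) :
    x = y ∨ triGraph.Adj x y := by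
  rcases h with h | h
  · left
    ext i; fin_cases i
    · exact h.1.symm
    · exact h.2.symm
  · exact Or.inr (siteEnd_adj_of_coords h)

/-- Adjacency in `𝕋` from coordinate patterns, with the four coordinates named. -/
theorem siteEnd_adj_of_coords' {x y : Site 2} {x0 x1 y0 y1 : ℤ} (hx0 : x 0 = x0) (hx1 : x 1 = x1)
    (hy0 : y 0 = y0) (hy1 : y 1 = y1)
    (h : (y0 = x0 + 1 ∧ y1 = x1) ∨ (y0 = x0 ∧ y1 = x1 + 1) ∨
      (x0 = y0 + 1 ∧ x1 = y1) ∨ (x0 = y0 ∧ x1 = y1 + 1) ∨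
      (y0 = x0 + 1 ∧ y1 = x1 - 1) ∨ (x0 = y0 + 1 ∧ x1 = y1 - 1)) :
    triGraph.Adj x y := by
  subst hx0 hx1 hy0 hy1
  exact siteEnd_adj_of_coords h

/-- Equality or adjacency in `𝕋` from coordinate patterns, with the four coordinates named. -/
theorem siteEnd_eq_or_adj_of_coords' {x y : Site 2} {x0 x1 y0 y1 : ℤ} (hx0 : x 0 = x0)
    (hx1 : x 1 = x1) (hy0 : y 0 = y0) (hy1 : y 1 = y1)
    (h : (y0 = x0 ∧ y1 = x1) ∨ (y0 = x0 + 1 ∧ y1 = x1) ∨ (y0 = x0 ∧ y1 = x1 + 1) ∨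
      (x0 = y0 + 1 ∧ x1 = y1) ∨ (x0 = y0 ∧ x1 = y1 + 1) ∨
      (y0 = x0 + 1 ∧ y1 = x1 - 1) ∨ (x0 = y0 + 1 ∧ x1 = y1 - 1)) :
    x = y ∨ triGraph.Adj x y := by
  subst hx0 hx1 hy0 hy1
  exact siteEnd_eq_or_adj_of_coords h

/-- **The halving map `v ↦ ⌊v/2⌋` is a weak graph homomorphism of `𝕋`**: adjacent fine sites have
equal or adjacent half-cells. -/
theorem siteEnd_half_eq_or_adj : ∀ {v w : Site 2}, triGraph.Adj v w →
    (fun i => v i / 2) = (fun i => w i / 2) ∨ triGraph.Adj (fun i => v i / 2) (fun i => w i / 2) := by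
  intro v w h
  have hc := triGraph_adj_apply h
  refine siteEnd_eq_or_adj_of_coords ?_
  omega

/-- Two distinct doubled vertices (all coordinates even) are never adjacent in `𝕋`. -/
theorem siteEnd_not_adj_of_even {v w : Site 2} (hv : ∀ i, (2 : ℤ) ∣ v i) (hw : ∀ i, (2 : ℤ) ∣ w i) :
    ¬ triGraph.Adj v w := fun h => by
  have hc := triGraph_adj_apply h
  obtain ⟨a, ha⟩ := hv 0; obtain ⟨b, hb⟩ := hv 1; obtain ⟨c, hc'⟩ := hw 0; obtain ⟨d, hd⟩ := hw 1
  omega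

/-- A fine neighbour `v` of a doubled vertex `w = 2z` has its half-cell among the three cells
`z, z - e₀, z - e₁` sharing the original vertex `z`. -/
theorem siteEnd_half_of_adj_even {v w : Site 2} (h : triGraph.Adj v w) (hw : ∀ i, (2 : ℤ) ∣ w i) :
    (v 0 / 2 = w 0 / 2 ∧ v 1 / 2 = w 1 / 2) ∨ (v 0 / 2 = w 0 / 2 - 1 ∧ v 1 / 2 = w 1 / 2) ∨
      (v 0 / 2 = w 0 / 2 ∧ v 1 / 2 = w 1 / 2 - 1) := by
  have hc := triGraph_adj_apply h
  obtain ⟨c, hc'⟩ := hw 0; obtain ⟨d, hd⟩ := hw 1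
  omega

/-- The three cells `z, z - e₀, z - e₁` around an original vertex are pairwise equal or adjacent
(a down-triangle of the cell lattice). -/
theorem siteEnd_eq_or_adj_of_near {z a b : Site 2}
    (ha : (a 0 = z 0 ∧ a 1 = z 1) ∨ (a 0 = z 0 - 1 ∧ a 1 = z 1) ∨ (a 0 = z 0 ∧ a 1 = z 1 - 1))
    (hb : (b 0 = z 0 ∧ b 1 = z 1) ∨ (b 0 = z 0 - 1 ∧ b 1 = z 1) ∨ (b 0 = z 0 ∧ b 1 = z 1 - 1)) :
    a = b ∨ triGraph.Adj a b := by
  refine siteEnd_eq_or_adj_of_coords ?_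
  omega


/-- Half-cell from its two coordinates. -/
theorem siteEnd_half_eq_of_coords {u a : Site 2} (h0 : u 0 / 2 = a 0) (h1 : u 1 / 2 = a 1) :
    (fun i => u i / 2) = a := by
  funext i; fin_cases i; exacts [h0, h1]

end Summit.CriticalPhenomena.CardyFormulaZ2.Cruxes.LoopLimitZ2EqT.HexSegment

end
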